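import Summits.AtomisticToContinuum.Crystallization.Theorems.HullExactificationCascadeHcpLandscapeGapStubGoodOfNoBadBondHeights

/-!
# Crux `HcpLandscapeGap` (route `HullExactificationCascade`, stmt-AtomisticToContinuum-12087),
# line `birth`: stub `stub_goodOfNoBadBondSlip` (slip-RG) — no bad bond, near-`h` spacings and
# near-hollow lateral bonds nearby ⇒ a `Good(4, θ)` chart, for LATERALLY SLIPPED layered sets

Slip analogue of RG (`HcpLandscapeGapBirth.stub_goodOfNoBadBondHeights`).  The layered set is
`S = {i' u + j' v + τ k + (H k) e₃}`: layer `k` is the triangular lattice of spacing `a'`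
translated in-plane by `τ k` (`τ k 2 = 0`) at height `H k`; the reference data `(s, p, q)` say
that the lateral bond `ξ k = τ (k+1) − τ k` is within `δ₁` of the hollow-type vector
`(s k) w + (p k) u + (q k) v`.  Fix `a, h > 0` and `θ > 0`.  There are `δ₁ > 0` and `K : ℕ` such
that for every `a'` with `|a' − a| ≤ δ₁`, every Hägg word `s`, heights `H` with gaps `≥ h/2`,
in-plane slips `τ`, corrections `p, q` and every site `P = i u + j v + τ m + (H m) e₃` whose layer
`m` has no bad bond, only `δ₁`-almost-`h` spacings and only `δ₁`-almost-hollow lateral bonds for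
`|k − m| ≤ K`, the radius-`4` neighbourhood of `P` in `S` is two-way `θ`-matched with
`P + A₂ '' (hcpStacking a h ∩ B̄(0, 4))` for a LINEAR isometry `A₂`.

Proof.  With the cumulative lateral deviation
`G k = τ k − (haggLabel s k) w − (haggLabel p k) u − (haggLabel q k) v` one has
`G (k+1) − G k = ξ k − ((s k) w + (p k) u + (q k) v)` (`haggLabel_succ`), so
`‖G k − G m‖ ≤ |k − m| δ₁ ≤ K δ₁` for `|k − m| ≤ K` (telescoping, `norm_sub_le_of_lateralSteps`),
and the slipped site `(k, i', j')` IS the registered multilattice site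
`barlowPosH a' H s k (i' + haggLabel p k) (j' + haggLabel q k)` translated by `G k`.  Hence,
relative to the base points, the slipped set differs from the UNIFORM stacking
`barlowStacking a' h s` re-based at `barlowPos a' h s m (i + haggLabel p m) (j + haggLabel q m)`
by the vector `(H k − H m − (k − m) h) e₃ + (G k − G m)` of norm `≤ 2 K δ₁ ≤ θ/2` on the layers
`|k − m| ≤ K` that meet the two windows (gap `h/2`, `sub_le_of_gap_le`; `x₃ = k h` in the uniform
stacking).  As in RG, `matched_of_noBadBond` (radius `R = 4 + θ/2`, tolerance `ε = θ/4`) and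
`exists_linearChart_of_matched_radius` give a linear chart `A₂` of the re-based uniform stacking
with tolerance `2ε = θ/2` out to radius `R`, and the remaining `θ/2` absorbs the discrepancy.
All `[folklore]`.
-/

noncomputable section

namespace Summit.AtomisticToContinuum.Crystallization.Theorems.HcpLandscapeGapBirth

open Literature.MathematicalPhysics.StatisticalMechanics
open Summit.AtomisticToContinuum.Crystallization.Theorems.PricedHcpWindowsIdealGeometry
  (matched_of_noBadBond)

/-- **Telescoping in a normed group.**  If `‖G (l+1) − G l‖ ≤ δ` for all `l` with `|l − m| ≤ K`,
then `‖G k − G m‖ ≤ K δ` for `|k − m| ≤ K` (normed analogue of `abs_sub_le_of_steps`).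
[folklore] -/
theorem norm_sub_le_of_lateralSteps {E : Type*} [SeminormedAddCommGroup E] {G : ℤ → E} {δ : ℝ}
    {m : ℤ} {K : ℕ} (hG : ∀ l : ℤ, |l - m| ≤ K → ‖G (l + 1) - G l‖ ≤ δ) {k : ℤ}
    (hk : |k - m| ≤ K) : ‖G k - G m‖ ≤ K * δ := by
  have hδ : 0 ≤ δ := (norm_nonneg _).trans (hG m (by simp))
  rcases le_total m k with hmk | hkm
  · -- `k = m + n`
    obtain ⟨n, rfl⟩ : ∃ n : ℕ, k = m + n := ⟨(k - m).toNat, by omega⟩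
    have hn : (n : ℤ) ≤ K := by rw [add_sub_cancel_left] at hk; exact (le_abs_self _).trans hk
    have h1 := dist_le_range_sum_of_dist_le (f := fun t : ℕ => G (m + t)) n (d := fun _ => δ)
      (fun {t} ht => by
        show dist (G (m + t)) (G (m + ((t + 1 : ℕ) : ℤ))) ≤ δ
        rw [dist_comm, dist_eq_norm, Nat.cast_succ, ← add_assoc]
        refine hG (m + t) ?_
        rw [add_sub_cancel_left, Nat.abs_cast]
        omega)
    rw [Finset.sum_const, Finset.card_range, nsmul_eq_mul, dist_comm, dist_eq_norm] at h1
    simp only [Nat.cast_zero, add_zero] at h1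
    calc ‖G (m + n) - G m‖ ≤ n * δ := h1
      _ ≤ K * δ := mul_le_mul_of_nonneg_right (by exact_mod_cast hn) hδ
  · -- `k = m - n`
    obtain ⟨n, rfl⟩ : ∃ n : ℕ, k = m - n := ⟨(m - k).toNat, by omega⟩
    have hn : (n : ℤ) ≤ K := by
      rw [sub_sub_cancel_left, abs_neg] at hk; exact (le_abs_self _).trans hk
    have h1 := dist_le_range_sum_of_dist_le (f := fun t : ℕ => G (m - t)) n (d := fun _ => δ)
      (fun {t} ht => by
        show dist (G (m - t)) (G (m - ((t + 1 : ℕ) : ℤ))) ≤ δ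
        have e : m - (t : ℤ) = m - ((t + 1 : ℕ) : ℤ) + 1 := by push_cast; ring
        rw [dist_eq_norm, e]
        refine hG _ ?_
        rw [show m - ((t + 1 : ℕ) : ℤ) - m = -((t + 1 : ℕ) : ℤ) by ring, abs_neg, Nat.abs_cast]
        omega)
    rw [Finset.sum_const, Finset.card_range, nsmul_eq_mul, dist_comm, dist_eq_norm] at h1
    simp only [Nat.cast_zero, sub_zero] at h1
    calc ‖G (m - n) - G m‖ ≤ n * δ := h1
      _ ≤ K * δ := mul_le_mul_of_nonneg_right (by exact_mod_cast hn) hδ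

/-- The slipped site `i' u + j' v + τ + t e₃` with an in-plane slip (`τ 2 = 0`) lies in the plane
`x₃ = t`. [folklore] -/
theorem slipSite_apply_two (a' t : ℝ) (i' j' : ℤ) {τ : EuclideanSpace ℝ (Fin 3)} (hτ : τ 2 = 0) :
    ((i' : ℝ) • triangularVec₁ a' + (j' : ℝ) • triangularVec₂ a' + τ + layerNormal t) 2 = t := by
  simp [triangularVec₁, triangularVec₂, layerNormal, hτ]

/-- **The slipped set is a translate, layer by layer, of the registered multilattice.**  With the
cumulative lateral deviation `G k = τ k − (haggLabel s k) w − (haggLabel p k) u − (haggLabel q k) v`: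
`G (k+1) − G k = (τ (k+1) − τ k) − ((s k) w + (p k) u + (q k) v)` and
`i' u + j' v + τ k + (H k) e₃ = barlowPosH a' H s k (i' + haggLabel p k) (j' + haggLabel q k) + G k`.
[folklore] -/
theorem exists_cumulativeSlip (a' : ℝ) (H : ℤ → ℝ) (s p q : ℤ → ℤ)
    (τ : ℤ → EuclideanSpace ℝ (Fin 3)) :
    ∃ G : ℤ → EuclideanSpace ℝ (Fin 3),
      (∀ k : ℤ, G (k + 1) - G k = (τ (k + 1) - τ k) - ((s k : ℝ) • barlowOffset a' +
        (p k : ℝ) • triangularVec₁ a' + (q k : ℝ) • triangularVec₂ a')) ∧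
      (∀ k i' j' : ℤ, (i' : ℝ) • triangularVec₁ a' + (j' : ℝ) • triangularVec₂ a' + τ k +
        layerNormal (H k) =
          barlowPosH a' H s k (i' + haggLabel p k) (j' + haggLabel q k) + G k) := by
  refine ⟨fun k => τ k - (haggLabel s k : ℝ) • barlowOffset a' -
    (haggLabel p k : ℝ) • triangularVec₁ a' - (haggLabel q k : ℝ) • triangularVec₂ a', ?_, ?_⟩
  · intro k
    simp only [haggLabel_succ, Int.cast_add]
    module
  · intro k i' j'
    simp only [barlowPosH, Int.cast_add]
    module

/-- **Stub slip-RG — no bad bond, near-`h` spacings and near-hollow lateral bonds nearby ⇒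
`Good(4, θ)` after a linear isometry, for laterally slipped layered sets** (slip analogue of RG
`stub_goodOfNoBadBondHeights`).  Constants: `R = 4 + θ/2`, `ε = θ/4`, `K = ⌈2(R + ε)/h⌉₊`,
`δ₁ = min (min (a/2) (h/2)) (min (ε/(2R(1/a + 1/h) + 1)) (θ/(4K + 1)))` (so `K δ₁ ≤ θ/4`).
For `|a' − a| ≤ δ₁`, a Hägg word `s`, heights `H` with gaps `≥ h/2`, in-plane slips `τ`,
corrections `p, q` and a site `P = i u + j v + τ m + (H m) e₃` with, for `|k − m| ≤ K`, no bad
bond `s (k+1) = s k`, spacings `|H (k+1) − H k − h| ≤ δ₁` and lateral bonds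
`‖(τ (k+1) − τ k) − ((s k) w + (p k) u + (q k) v)‖ ≤ δ₁`: for some linear isometry `A₂`,
(1) every hcp point `q'` of norm `≤ 4` has a point `z` of the slipped set with
`dist z P ≤ 4 + θ` and `dist z (P + A₂ q') ≤ θ`, and (2) every point `z` of the slipped set with
`dist z P ≤ 4` has an hcp point `q'` with `dist z (P + A₂ q') ≤ θ` (the slipped site
`(k, i', j')` is the registered site `(k, i' + haggLabel p k, j' + haggLabel q k)` moved by the
cumulative deviation `G k`, `‖G k − G m‖ ≤ K δ₁ ≤ θ/4`; compare with the uniform stacking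
re-based at `barlowPos a' h s m (i + haggLabel p m) (j + haggLabel q m)`, total discrepancy
`≤ θ/2` on the layers `|k − m| ≤ K` meeting the windows; `matched_of_noBadBond` +
`exists_linearChart_of_matched_radius` with tolerance `2ε = θ/2`). [folklore] -/
theorem stub_goodOfNoBadBondSlip : ∀ (a h : ℝ), 0 < a → 0 < h → ∀ θ : ℝ, 0 < θ → ∃ δ₁ : ℝ, 0 < δ₁ ∧ ∃ K : ℕ, ∀ a' : ℝ, |a' - a| ≤ δ₁ → ∀ s : ℤ → ℤ, Literature.MathematicalPhysics.StatisticalMechanics.IsHaggSeq s → ∀ H : ℤ → ℝ, (∀ k : ℤ, h / 2 ≤ H (k + 1) - H k) → ∀ τ : ℤ → EuclideanSpace ℝ (Fin 3), (∀ k : ℤ, τ k 2 = 0) → ∀ (p q : ℤ → ℤ) (m i j : ℤ), (∀ k : ℤ, |k - m| ≤ K → s (k + 1) ≠ s k) → (∀ k : ℤ, |k - m| ≤ K → |H (k + 1) - H k - h| ≤ δ₁) → (∀ k : ℤ, |k - m| ≤ K → ‖(τ (k + 1) - τ k) - ((s k : ℝ) • Literature.MathematicalPhysics.StatisticalMechanics.barlowOffset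 a' + (p k : ℝ) • Literature.MathematicalPhysics.StatisticalMechanics.triangularVec₁ a' + (q k : ℝ) • Literature.MathematicalPhysics.StatisticalMechanics.triangularVec₂ a')‖ ≤ δ₁) → ∃ A₂ : EuclideanSpace ℝ (Fin 3) →ₗᵢ[ℝ] EuclideanSpace ℝ (Fin 3), (∀ q' ∈ Literature.MathematicalPhysics.StatisticalMechanics.hcpStacking a h, ‖q'‖ ≤ 4 → ∃ z ∈ {x : EuclideanSpace ℝ (Fin 3) | ∃ k i' j' : ℤ, x = (i' : ℝ) • Literature.MathematicalPhysics.StatisticalMechanics.triangularVec₁ a' + (j' : ℝ) • Literature.MathematicalPhysics.StatisticalMechanics.triangularVec₂ a' + τ k + Literature.MathematicalPhysics.StatisticalMechanics.layerNormal (H k)}, dist z ((i : ℝ) • Literature.MathematicalPhysics.StatisticalMechanics.triangularVec₁ a' + (j : ℝ) • Literature.MathematicalPhysics.StatisticalMechanics.triangularVec₂ a' + τ m + Literature.MathematicalPhysics.StatisticalMechanics.layerNormal (H m)) ≤ 4 + θ ∧ dist z ((i : ℝ) • Literature.MathematicalPhysics.StatisticalMechanics.triangularVec₁ a' + (j : ℝ)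 • Literature.MathematicalPhysics.StatisticalMechanics.triangularVec₂ a' + τ m + Literature.MathematicalPhysics.StatisticalMechanics.layerNormal (H m) + A₂ q') ≤ θ) ∧ (∀ z ∈ {x : EuclideanSpace ℝ (Fin 3) | ∃ k i' j' : ℤ, x = (i' : ℝ) • Literature.MathematicalPhysics.StatisticalMechanics.triangularVec₁ a' + (j' : ℝ) • Literature.MathematicalPhysics.StatisticalMechanics.triangularVec₂ a' + τ k + Literature.MathematicalPhysics.StatisticalMechanics.layerNormal (H k)}, dist z ((i : ℝ) • Literature.MathematicalPhysics.StatisticalMechanics.triangularVec₁ a' + (j : ℝ) • Literature.MathematicalPhysics.StatisticalMechanics.triangularVec₂ a' + τ m + Literature.MathematicalPhysics.StatisticalMechanics.layerNormal (H m)) ≤ 4 → ∃ q' ∈ Literature.MathematicalPhysics.StatisticalMechanics.hcpStacking a h, dist z ((i : ℝ) • Literature.MathematicalPhysics.StatisticalMechanics.triangularVec₁ a' + (j : ℝ) • Literature.MathematicalPhysics.StatisticalMechanics.triangularVec₂ a' + τ m + Literature.MathematicalPhysics.StatisticalMechanics.layerNormal (H m) + A₂ q') ≤ θ) := by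
  intro a h ha hh θ hθ
  -- constants: `R = 4 + θ/2`, `ε = θ/4`, `K = ⌈2(R + ε)/h⌉₊`, then `δ₁` with `K δ₁ ≤ θ/4`
  set R : ℝ := 4 + θ / 2 with hR
  set ε : ℝ := θ / 4 with hε
  have hε0 : 0 < ε := by positivity
  have hR0 : 0 < R := by positivity
  have hM : 0 ≤ 2 * R * (1 / a + 1 / h) := by positivity
  set K : ℕ := ⌈2 * (R + ε) / h⌉₊ with hKdef
  have hK : R + ε ≤ (K : ℝ) * (h / 2) := by
    have h1 := Nat.le_ceil (2 * (R + ε) / h)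
    calc R + ε = 2 * (R + ε) / h * (h / 2) := by field_simp
      _ ≤ _ := mul_le_mul_of_nonneg_right h1 (by positivity)
  have hK0 : (0 : ℝ) ≤ K := Nat.cast_nonneg _
  refine ⟨min (min (a / 2) (h / 2)) (min (ε / (2 * R * (1 / a + 1 / h) + 1)) (θ / (4 * K + 1))),
    by positivity, K, ?_⟩
  intro a' haδ s hs H hgap τ hτ p q m i j hgood hH hlat
  set δ₁ : ℝ := min (min (a / 2) (h / 2)) (min (ε / (2 * R * (1 / a + 1 / h) + 1)) (θ / (4 * K + 1)))
    with hδ₁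
  -- the scale bounds
  have hδa : δ₁ ≤ a / 2 := (min_le_left _ _).trans (min_le_left _ _)
  have hδh : δ₁ ≤ h / 2 := (min_le_left _ _).trans (min_le_right _ _)
  have hδ0 : 0 ≤ δ₁ := (abs_nonneg _).trans haδ
  have hδε : δ₁ * (2 * R * (1 / a + 1 / h)) ≤ ε := by
    calc δ₁ * (2 * R * (1 / a + 1 / h))
        ≤ ε / (2 * R * (1 / a + 1 / h) + 1) * (2 * R * (1 / a + 1 / h)) :=
          mul_le_mul_of_nonneg_right ((min_le_right _ _).trans (min_le_left _ _)) hM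
      _ ≤ ε := by
          rw [div_mul_eq_mul_div, div_le_iff₀ (by positivity)]
          nlinarith
  have hKδ : (K : ℝ) * δ₁ ≤ θ / 4 := by
    calc (K : ℝ) * δ₁ ≤ K * (θ / (4 * K + 1)) :=
          mul_le_mul_of_nonneg_left ((min_le_right _ _).trans (min_le_right _ _)) hK0
      _ ≤ θ / 4 := by
          rw [mul_div_assoc', div_le_div_iff₀ (by positivity) (by positivity)]
          nlinarith
  have ha' : a' ≠ 0 := by
    intro h0
    rw [h0, zero_sub, abs_neg, abs_of_pos ha] at haδ
    linarith
  have hhδ : |h - h| ≤ δ₁ := by rwa [sub_self, abs_zero]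
  -- re-base the word at layer `m`: `s' = s (· + m)` has no bad bond within `K` of `0`
  set s' : ℤ → ℤ := fun n => s (n + m) with hs'
  have hs'H : IsHaggSeq s' := isHaggSeq_shift hs m
  have hgood' : ∀ k : ℤ, |k - 0| ≤ (K : ℕ) → s' (k + 1) ≠ s' k := by
    intro k hk
    have hk' : |k + m - m| ≤ (K : ℕ) := by rwa [add_sub_cancel_right, ← sub_zero k]
    have e := hgood (k + m) hk'
    simp only [hs']
    rwa [show k + 1 + m = k + m + 1 by ring]
  obtain ⟨g, hg1, hg2⟩ := matched_of_noBadBond ha hh hε0.le hδa hδh hδε hK ha' hh.ne' haδ hhδ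
    hs'H (m := 0) hgood'
  have hx0 : barlowPos a' h s' 0 0 0 = 0 := by simp [barlowPos]
  have h0 : (0 : EuclideanSpace ℝ (Fin 3)) ∈ barlowStacking a' h s' := hx0 ▸ barlowPos_mem 0 0 0
  rw [hx0] at hg1 hg2
  -- the linear chart at the origin of the re-based uniform stacking
  obtain ⟨A, hA1, hA2⟩ := exists_linearChart_of_matched_radius (a := a) (h := h) hε0.le
    (show 4 + ε ≤ R by rw [hR, hε]; linarith) h0 hg1 hg2
  -- the cumulative lateral deviation and the registered description of the slipped sites
  obtain ⟨G, hGstep, hslip⟩ := exists_cumulativeSlip a' H s p q τ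
  have hGK : ∀ k : ℤ, |k - m| ≤ (K : ℤ) → ‖G k - G m‖ ≤ θ / 4 := fun k hk =>
    (norm_sub_le_of_lateralSteps (G := G) (δ := δ₁) (m := m) (K := K)
      (fun l hl => by rw [hGstep]; exact hlat l hl) hk).trans hKδ
  -- base points
  set i₀ : ℤ := i + haggLabel p m with hi₀
  set j₀ : ℤ := j + haggLabel q m with hj₀
  set Pu := barlowPos a' h s m i₀ j₀ with hPu
  set pp := barlowPosH a' H s m i₀ j₀ with hpp
  have hP : (i : ℝ) • triangularVec₁ a' + (j : ℝ) • triangularVec₂ a' + τ m + layerNormal (H m) =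
      pp + G m := hslip m i j
  -- the discrepancy vector and its bound
  have hvert : ∀ k : ℤ, |k - m| ≤ (K : ℤ) →
      ‖(layerNormal (H k - H m - ((k : ℝ) - m) * h) : EuclideanSpace ℝ (Fin 3))‖ ≤ θ / 4 := by
    intro k hk
    rw [norm_layerNormal]
    have h1 := abs_sub_le_of_steps (G := fun l : ℤ => H l - (l : ℝ) * h) (δ := δ₁) (m := m)
      (K := K) (fun l hl => by
        have e : H (l + 1) - (((l + 1 : ℤ)) : ℝ) * h - (H l - (l : ℝ) * h) =
            H (l + 1) - H l - h := by
          push_cast; ring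
        rw [e]
        exact hH l hl) hk
    have e : H k - (k : ℝ) * h - (H m - (m : ℝ) * h) = H k - H m - ((k : ℝ) - m) * h := by ring
    rw [e] at h1
    exact h1.trans hKδ
  have hW : ∀ k : ℤ, |k - m| ≤ (K : ℤ) →
      ‖(layerNormal (H k - H m - ((k : ℝ) - m) * h) : EuclideanSpace ℝ (Fin 3)) + (G k - G m)‖
        ≤ θ / 2 := by
    intro k hk
    calc _ ≤ ‖(layerNormal (H k - H m - ((k : ℝ) - m) * h) : EuclideanSpace ℝ (Fin 3))‖ +
          ‖G k - G m‖ := norm_add_le _ _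
      _ ≤ θ / 4 + θ / 4 := add_le_add (hvert k hk) (hGK k hk)
      _ = θ / 2 := by ring
  have hkey : ∀ k i' j' : ℤ, barlowPosH a' H s k i' j' + G k - (pp + G m) =
      (barlowPos a' h s k i' j' - Pu) +
        (layerNormal (H k - H m - ((k : ℝ) - m) * h) + (G k - G m)) := by
    intro k i' j'
    have e := barlowPosH_sub_barlowPosH_eq a' h H s m i₀ j₀ k i' j'
    rw [← add_assoc, ← e]
    abel
  have hθε : 2 * ε + θ / 2 = θ := by rw [hε]; ring
  rw [hP]
  refine ⟨A, ?_, ?_⟩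
  · -- clause 1: an hcp point `q'` of norm `≤ 4`
    intro q' hq' hq4
    obtain ⟨y, hy, hyd⟩ := hA1 q' hq' hq4
    obtain ⟨k', i'', j'', rfl⟩ := hy
    have hny : ‖barlowPos a' h s' k' i'' j''‖ ≤ 4 + 2 * ε := by
      calc ‖barlowPos a' h s' k' i'' j''‖
          ≤ ‖barlowPos a' h s' k' i'' j'' - A q'‖ + ‖A q'‖ := norm_le_norm_sub_add _ _
        _ ≤ 2 * ε + 4 := by rw [← dist_eq_norm, A.norm_map]; exact add_le_add hyd hq4
        _ = 4 + 2 * ε := by ring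
    -- its layer `k' + m` has `|k'| ≤ K`
    have hk' : |k' + m - m| ≤ (K : ℤ) := by
      rw [add_sub_cancel_right]
      have h2 : |(k' : ℝ) * h| ≤ 4 + 2 * ε := by
        have h3 := PiLp.norm_apply_le (barlowPos a' h s' k' i'' j'') 2
        rw [barlowPos_apply_two, Real.norm_eq_abs] at h3
        exact h3.trans hny
      rw [abs_mul, abs_of_pos hh] at h2
      have h3 : |(k' : ℝ)| * h ≤ K * h := by
        calc |(k' : ℝ)| * h ≤ 4 + 2 * ε := h2
          _ = R := by rw [hR, hε]; ring
          _ ≤ R + ε := le_add_of_nonneg_right hε0.le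
          _ ≤ K * (h / 2) := hK
          _ ≤ K * h := by nlinarith
      have h4 : |(k' : ℝ)| ≤ K := le_of_mul_le_mul_right h3 hh
      exact_mod_cast h4
    have hyP : barlowPos a' h s (k' + m) (i'' + i₀) (j'' + j₀) - Pu = barlowPos a' h s' k' i'' j'' := by
      rw [hPu, ← barlowPos_add_barlowPos_shift, add_sub_cancel_left]
    have hzp := hkey (k' + m) (i'' + i₀) (j'' + j₀)
    rw [hyP] at hzp
    refine ⟨(((i'' + i₀ - haggLabel p (k' + m) : ℤ)) : ℝ) • triangularVec₁ a' +
        (((j'' + j₀ - haggLabel q (k' + m) : ℤ)) : ℝ) • triangularVec₂ a' + τ (k' + m) +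
        layerNormal (H (k' + m)), ⟨k' + m, _, _, rfl⟩, ?_, ?_⟩
    · rw [hslip, sub_add_cancel, sub_add_cancel, dist_eq_norm, hzp]
      calc ‖barlowPos a' h s' k' i'' j'' +
            (layerNormal (H (k' + m) - H m - (((k' + m : ℤ) : ℝ) - m) * h) + (G (k' + m) - G m))‖
          ≤ ‖barlowPos a' h s' k' i'' j''‖ +
              ‖(layerNormal (H (k' + m) - H m - (((k' + m : ℤ) : ℝ) - m) * h) :
                EuclideanSpace ℝ (Fin 3)) + (G (k' + m) - G m)‖ := norm_add_le _ _
        _ ≤ (4 + 2 * ε) + θ / 2 := add_le_add hny (hW _ hk')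
        _ = 4 + θ := by rw [hε]; ring
    · rw [hslip, sub_add_cancel, sub_add_cancel, dist_eq_norm, ← sub_sub, hzp,
        add_sub_right_comm]
      calc ‖barlowPos a' h s' k' i'' j'' - A q' +
            (layerNormal (H (k' + m) - H m - (((k' + m : ℤ) : ℝ) - m) * h) + (G (k' + m) - G m))‖
          ≤ ‖barlowPos a' h s' k' i'' j'' - A q'‖ +
              ‖(layerNormal (H (k' + m) - H m - (((k' + m : ℤ) : ℝ) - m) * h) :
                EuclideanSpace ℝ (Fin 3)) + (G (k' + m) - G m)‖ := norm_add_le _ _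
        _ ≤ 2 * ε + θ / 2 := add_le_add (by rw [← dist_eq_norm]; exact hyd) (hW _ hk')
        _ = θ := hθε
  · -- clause 2: a slipped point `z` with `dist z P ≤ 4`
    intro z hz hz4
    obtain ⟨k, i', j', rfl⟩ := hz
    -- its layer has `|k - m| ≤ K` by the gap `h/2`
    have hHk : |H k - H m| ≤ 4 := by
      have h3 := PiLp.dist_apply_le
        ((i' : ℝ) • triangularVec₁ a' + (j' : ℝ) • triangularVec₂ a' + τ k + layerNormal (H k))
        ((i : ℝ) • triangularVec₁ a' + (j : ℝ) • triangularVec₂ a' + τ m + layerNormal (H m)) 2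
      rw [slipSite_apply_two a' (H k) i' j' (hτ k), slipSite_apply_two a' (H m) i j (hτ m),
        Real.dist_eq, hP] at h3
      exact h3.trans hz4
    have hkm : |k - m| ≤ (K : ℤ) := by
      have h1 : |(k : ℝ) - m| * (h / 2) ≤ |H k - H m| := by
        rcases le_total m k with hmk | hkm
        · have h2 := sub_le_of_gap_le H hgap hmk
          have h3 : (0 : ℝ) ≤ (k : ℝ) - m := by
            have : (m : ℝ) ≤ k := by exact_mod_cast hmk
            linarith
          rw [abs_of_nonneg h3]
          exact h2.trans (le_abs_self _)
        · have h2 := sub_le_of_gap_le H hgap hkm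
          have h3 : (0 : ℝ) ≤ (m : ℝ) - k := by
            have : (k : ℝ) ≤ m := by exact_mod_cast hkm
            linarith
          rw [abs_sub_comm, abs_of_nonneg h3, abs_sub_comm]
          exact h2.trans (le_abs_self _)
      have h2 : |(k : ℝ) - m| * (h / 2) ≤ K * (h / 2) := by
        calc |(k : ℝ) - m| * (h / 2) ≤ 4 := h1.trans hHk
          _ ≤ R + ε := by rw [hR]; linarith
          _ ≤ K * (h / 2) := hK
      have h3 : |(k : ℝ) - m| ≤ K := le_of_mul_le_mul_right h2 (by positivity)
      exact_mod_cast h3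
    set y := barlowPos a' h s k (i' + haggLabel p k) (j' + haggLabel q k) - Pu with hy
    have hyS : y ∈ barlowStacking a' h s' :=
      (mem_barlowStacking_iff_sub_mem_shift (m := m) (i₀ := i₀) (j₀ := j₀) _).1
        (barlowPos_mem _ _ _)
    have hzp := hkey k (i' + haggLabel p k) (j' + haggLabel q k)
    have hny : ‖y‖ ≤ R := by
      have e : y = (barlowPosH a' H s k (i' + haggLabel p k) (j' + haggLabel q k) + G k -
          (pp + G m)) - (layerNormal (H k - H m - ((k : ℝ) - m) * h) + (G k - G m)) := by
        rw [hzp, add_sub_cancel_right]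
      calc ‖y‖ ≤ ‖barlowPosH a' H s k (i' + haggLabel p k) (j' + haggLabel q k) + G k - (pp + G m)‖ +
            ‖(layerNormal (H k - H m - ((k : ℝ) - m) * h) : EuclideanSpace ℝ (Fin 3)) +
              (G k - G m)‖ := by
            rw [e]; exact norm_sub_le _ _
        _ ≤ 4 + θ / 2 :=
            add_le_add (by rw [← dist_eq_norm, ← hslip]; exact hz4) (hW k hkm)
        _ = R := by rw [hR]
    obtain ⟨q', hq', hqd⟩ := hA2 y hyS hny
    refine ⟨q', hq', ?_⟩
    rw [hslip, dist_eq_norm, ← sub_sub, hzp, add_sub_right_comm]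
    calc ‖y - A q' + (layerNormal (H k - H m - ((k : ℝ) - m) * h) + (G k - G m))‖
        ≤ ‖y - A q'‖ +
            ‖(layerNormal (H k - H m - ((k : ℝ) - m) * h) : EuclideanSpace ℝ (Fin 3)) +
              (G k - G m)‖ := norm_add_le _ _
      _ ≤ 2 * ε + θ / 2 := add_le_add (by rw [← dist_eq_norm]; exact hqd) (hW k hkm)
      _ = θ := hθε

end Summit.AtomisticToContinuum.Crystallization.Theorems.HcpLandscapeGapBirth

end
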